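import Literature.MathematicalPhysics.QuantumFieldTheory.Balaban1983to89.B9Eq325RLipschitzClosed

/-!
# `Balaban1983to89.B9Eq325RLipschitzClosedLinear` — T. Bałaban, *Propagators for lattice gauge theories in a background field*, Commun. Math.
# Phys. **99** (1985) 389–434 [Balaban1985BackgroundPropagators] p. 403 with (3.25) p. 394 and (3.68) p. 403: **THE α-LINEAR DISPLAY OF THE
# CLOSED R-LETTER — `‖R(U) − R(1)‖ ≤ C_lin(d, a′, K, α₀)·α` on Bałaban's diagonal for `α ≤ α₀`** — the shape the principal-operator assembly
# ((SC)'s `hR`∕`δ_R` slot) consumes; sequel of `B9Eq325RLipschitzClosed` (route R2′ STEP B7′ S3)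

statement-level skeleton of published theorems with citation tags; proofs where landed; nothing here is a claim about the Yang–Mills mass gap

CITATION HEADER (lean-in-tree rule).  Audit cell `pub-balaban`, sub-cell `t4`, BINDER row NE9; filed by NE9 formalisation-swarm leaf prover 06
(`b2b-balaban-t4-ne9-formalise-leaf-06`, gen 64) answering the NE9 desk's pre-read of the S3 closure (PRICING-NE9 v65, journal l.46836∕INBOX: «`O(α)` by
inspection, the α-LINEAR display for (SC)'s `hR` slot owed»).  Source READ: [Balaban1985BackgroundPropagators] p. 403 *«R(U), P(U) = I − R(U) extend
analytically to the domain (3.37) and satisfy the same bounds»*, (3.68) *«P(U′U) = P(U) − P′(A)»* (the remainder LINEAR in the perturbation).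

WHAT IS PROVED (sorry-free; proof lane; [folklore] real arithmetic on the displayed closed forms of `B9Eq325RLipschitzClosed`; nothing of [B9] asserted).
* §1 `CR_le_linear` — monotonicity of S3d's displayed polynomial `C_R♯(γ, M_Q, θ_G, θ_Q, κ, δ_K)` in its letters: slopes `θ_G ≤ s_G α`, `θ_Q ≤ s_Q α`,
  `δ_K ≤ s_K α` and floors `γ ≥ γ_m > 0`, `κ ≥ κ_m > 0`, `M_Q ≤ M` give `C_R♯ ≤ C_lin·α`, `C_lin = C_R♯(γ_m, M, s_G, s_Q, κ_m, s_K)`.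
* §2 **`norm_RofU_sub_RofU_one_le_linear`** — ON THE DIAGONAL `ηL = 1`, `c₀L^d = c₁`,
  `εR = Kαη`, for `0 ≤ α ≤ α₀`: `‖R(U)f − R(1)f‖ ≤ C_lin·α·‖f‖` with `C_lin` a closed function of `(d, a′, K, α₀)` through the displayed
  `γ_m = γ(α₀)`, `M = e^{dKα₀}`, `s_Q = dK·e^{dKα₀}`, `s_G`, `s_K`, `κ_m = κ₀ − s_K·α₀`, where `κ₀` is the FORM minorant of the flat third
  operator `Q̃′G′(1)²Q̃′†` (slot `hκ1`, NE9 leaf-01's `qggq_coercive_one` ∕ `…Sharp` shape — a LETTER, not hard-wired), under the window `0 < γ_m`, `0 < κ_m`.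
HONEST SCOPE.  Arithmetic only; the numerical size of `C_lin` is that of the closure (see its HONEST SCOPE: void with the tree's tent floor `κ₀ ∼ 10⁻¹⁷` at
`d = 4`, finite with the true flat constant `≈ 3–5·10⁻⁴` computed by t4-ne9-idea-1 g87 ∕ leaf-06 g64 j172624, pending NE9 leaf-01's sharper Lean
certificate); ONE display of one route sub-step, NOT NE9 (cell pub-balaban: NE9 NOT PRINTED ∕ NOT PROVED; «NE9 ⇐ the named binders»; spine PROVED 0∕9;
rung (B)+1 on a finite T⁴ — NOT infinite volume, NOT mass gap, NOT Clay; HONEST DEPENDENCY: continuum YM on T⁴ ⇐ BetaPertH ∧ nine spine estimates (0/9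
proved); BetaPertH ⇐ (D1) ∧ (D4) ∧ CAP+tail; G-an2-4 gates asym, D1 and NE2/3/4).  NEW file; nothing modified.  Net new unproved facts: 0.
-/

noncomputable section

open scoped InnerProductSpace

namespace Literature.MathematicalPhysics.QuantumFieldTheory.Balaban1983to89.B9Eq325RLipschitzClosedLinear

open B9SectCLatticeCarrier (Bond)
open B9Eq319QprimeTorus (fineP)
open B11Eq103H1Complex (SiteL2K)
open B9Eq310HessianOperator (adTransportW)
open B9Eq326OperatorAssembly (RofU)
open B4Sect5Torus (TSite)
open B9Eq311L2Pairing (WL2)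
open B9Eq326OperatorAssembly (QprimeW)
open B9Eq3119DeltaPiCarrier (GpOfU)
open B9Thm311DeltaPrimeA (laplacePrimeA_one_pos)
open B9Eq325RLipschitzClosed (norm_RofU_sub_RofU_one_le_of_letters rho_le_exp_sub_one)

/-! ## §1 Monotonicity of `C_R♯` in its letters -/

/-- **`C_R♯` IS MONOTONE IN ITS LETTERS AND FIRST ORDER IN `(θ_G, θ_Q, δ_K)`**: slopes `θ_G ≤ s_G·α`, `θ_Q ≤ s_Q·α`, `δ_K ≤ s_K·α` and floors
`0 < γ_m ≤ γ`, `0 < κ_m ≤ κ`, `0 ≤ M_Q ≤ M` give `C_R♯(γ, M_Q, θ_G, θ_Q, κ, δ_K) ≤ C_R♯(γ_m, M, s_G, s_Q, κ_m, s_K)·α`. [folklore]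
[cite: Balaban1985BackgroundPropagators, (3.68) p.403, p.403] -/
theorem CR_le_linear {α γ γm MQ M θG sG θQ sQ κ κm δK sK : ℝ}
    (hγm : 0 < γm) (hγ : γm ≤ γ) (hκm : 0 < κm) (hκ : κm ≤ κ) (hMQ0 : 0 ≤ MQ) (hMQ : MQ ≤ M)
    (hθG0 : 0 ≤ θG) (hθG : θG ≤ sG * α) (hθQ0 : 0 ≤ θQ) (hθQ : θQ ≤ sQ * α) (hδK0 : 0 ≤ δK) (hδK : δK ≤ sK * α) :
    γ⁻¹ * (MQ * (κ⁻¹ * (MQ * θG + θQ * γ⁻¹) + κ⁻¹ * δK * κ⁻¹ * (MQ * γ⁻¹)) + θQ * (κ⁻¹ * (MQ * γ⁻¹))) +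
        θG * (MQ * (κ⁻¹ * (MQ * γ⁻¹))) ≤
      (γm⁻¹ * (M * (κm⁻¹ * (M * sG + sQ * γm⁻¹) + κm⁻¹ * sK * κm⁻¹ * (M * γm⁻¹)) + sQ * (κm⁻¹ * (M * γm⁻¹))) +
        sG * (M * (κm⁻¹ * (M * γm⁻¹)))) * α := by
  have hγ0 : 0 < γ := lt_of_lt_of_le hγm hγ
  have hκ0 : 0 < κ := lt_of_lt_of_le hκm hκ
  have hgi : γ⁻¹ ≤ γm⁻¹ := by rw [inv_le_inv₀ hγ0 hγm]; exact hγ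
  have hki : κ⁻¹ ≤ κm⁻¹ := by rw [inv_le_inv₀ hκ0 hκm]; exact hκ
  have hgi0 : 0 ≤ γ⁻¹ := by positivity
  have hki0 : 0 ≤ κ⁻¹ := by positivity
  have hM0 : 0 ≤ M := hMQ0.trans hMQ
  have hsG0 : 0 ≤ sG * α := hθG0.trans hθG
  have hsQ0 : 0 ≤ sQ * α := hθQ0.trans hθQ
  have hsK0 : 0 ≤ sK * α := hδK0.trans hδK
  have e : (γm⁻¹ * (M * (κm⁻¹ * (M * sG + sQ * γm⁻¹) + κm⁻¹ * sK * κm⁻¹ * (M * γm⁻¹)) + sQ * (κm⁻¹ * (M * γm⁻¹))) +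
        sG * (M * (κm⁻¹ * (M * γm⁻¹)))) * α =
      γm⁻¹ * (M * (κm⁻¹ * (M * (sG * α) + (sQ * α) * γm⁻¹) + κm⁻¹ * (sK * α) * κm⁻¹ * (M * γm⁻¹)) + (sQ * α) * (κm⁻¹ * (M * γm⁻¹))) +
        (sG * α) * (M * (κm⁻¹ * (M * γm⁻¹))) := by ring
  rw [e]
  gcongr

/-! ## §2 The diagonal slopes and the α-linear display -/

section Diagonal

variable {d : ℕ} (L : ℕ) [NeZero L] (m : Fin d → ℕ)
  {𝔸 : Type*} [Ring 𝔸] [Algebra ℂ 𝔸]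
  {W : Type*} [NormedAddCommGroup W] [InnerProductSpace ℂ W] [FiniteDimensional ℂ W] (φ : W ≃ₗ[ℂ] 𝔸)
  (c₀ : ℝ) [Fact (0 < c₀)] (η : ℝ) (c₁ : ℝ) [Fact (0 < c₁)] {a' : ℝ} (ha' : 0 < a')
  (U : Bond d (fineP L m) → 𝔸ˣ)
  (hRS : ∀ (b : Bond d (fineP L m)) (v u : W), ⟪adTransportW φ U b v, u⟫_ℂ = ⟪v, adTransportW φ (fun b => (U b)⁻¹) b u⟫_ℂ)
  {K α : ℝ} (hK : 0 ≤ K) (hα : 0 ≤ α) (hRε : ∀ (b : Bond d (fineP L m)) (w : W), ‖adTransportW φ U b w - w‖ ≤ K * α * η * ‖w‖)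

include ha' hRS hK hα hRε

/-- **THE α-LINEAR DISPLAY ON BAŁABAN's DIAGONAL**: at `ηL = 1`, `c₀L^d = c₁`, transporters `Kαη`-close to the identity, `η ≠ 0`, `0 < a′`,
and `0 ≤ α ≤ α₀`: with the displayed closed forms `M = e^{dKα₀}`, `s_Q = dK·M`, `γ_m = 1∕(2+2∕a′) − (√dKα₀ + (√dKα₀)² + a′(M−1)(2 + (M−1)))`,
`s_G = 2√dK·γ_m⁻¹(√γ_m)⁻¹ + |a′|s_Q(M + M)γ_m⁻²`, `s_K = M(γ_m⁻¹(γ_m⁻¹s_Q + s_GM) + s_Gγ_m⁻¹M) + s_Qγ_m⁻²M`, `κ_m = κ₀ − s_K·α₀` (`κ₀` the FORM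
minorant of `Q̃′G′(1)²Q̃′†`, slot `hκ1` — any certificate: the tree's `qggq_coercive_one`, NE9 leaf-01's sharper one) and the window `0 < γ_m`, `0 < κ_m`: `‖R(U)f − R(1)f‖ ≤ C_R♯(γ_m, M, s_G, s_Q, κ_m, s_K)·α·‖f‖` — `δ_R = C_lin(d, a′, K, α₀)·α`, the shape the
principal-operator assembly consumes; `B9Eq325RLipschitzClosed.norm_RofU_sub_RofU_one_le_of_letters` at `t = Kα`, `ρ = e^{dKα} − 1`, `s = 1` + §1 +
the slope `e^x − 1 ≤ xe^x` and monotonicity in `α`.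
[cite: Balaban1985BackgroundPropagators, p.403, (3.68) p.403, (3.25) p.394, Thm 3.11 p.416] -/
theorem norm_RofU_sub_RofU_one_le_linear (hη : η ≠ 0) (hηL : η * L = 1) (hw : c₀ * (L : ℝ) ^ d = c₁) {κ₀ α₀ M sQ γm sG sK κm : ℝ}
    (hκ1 : ∀ ψ : SiteL2K ℂ d m c₁ W, κ₀ * ‖ψ‖ ^ 2 ≤ RCLike.re ⟪ψ,
      (((WL2.linearEquiv ℂ ℂ (fun _ : TSite d m => c₁)).symm.toLinearMap ∘ₗ
          QprimeW L m φ (fun _ : Bond d (fineP L m) => (1 : 𝔸ˣ)) (c₀ := c₀)) ∘ₗ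
        GpOfU L m φ η (fun _ : Bond d (fineP L m) => (1 : 𝔸ˣ)) a' (c₁ := c₁) (laplacePrimeA_one_pos L m φ η a' hη ha') ∘ₗ
        GpOfU L m φ η (fun _ : Bond d (fineP L m) => (1 : 𝔸ˣ)) a' (c₁ := c₁) (laplacePrimeA_one_pos L m φ η a' hη ha') ∘ₗ
        LinearMap.adjoint ((WL2.linearEquiv ℂ ℂ (fun _ : TSite d m => c₁)).symm.toLinearMap ∘ₗ
          QprimeW L m φ (fun _ : Bond d (fineP L m) => (1 : 𝔸ˣ)) (c₀ := c₀))) ψ⟫_ℂ)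
    (hα0 : α ≤ α₀) (hMdef : M = Real.exp (d * K * α₀)) (hsQdef : sQ = d * K * M)
    (hγmdef : γm = 1 / (2 + 2 / a') - (Real.sqrt d * (K * α₀) + (Real.sqrt d * (K * α₀)) ^ 2 + a' * (M - 1) * (2 + (M - 1))))
    (hsGdef : sG = 2 * (Real.sqrt d * K) * (γm⁻¹ * (Real.sqrt γm)⁻¹) + (|a'| * sQ * (M + M)) * γm⁻¹ ^ 2)
    (hsKdef : sK = M * (γm⁻¹ * (γm⁻¹ * sQ + sG * M) + sG * (γm⁻¹ * M)) + sQ * (γm⁻¹ * (γm⁻¹ * M)))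
    (hκmdef : κm = κ₀ - sK * α₀) (hγm : 0 < γm) (hκm : 0 < κm)
    (f : SiteL2K ℂ d (fineP L m) c₀ W) :
    ‖RofU L m φ η U (c₀ := c₀) f - RofU L m φ η (fun _ : Bond d (fineP L m) => (1 : 𝔸ˣ)) (c₀ := c₀) f‖ ≤
      (γm⁻¹ * (M * (κm⁻¹ * (M * sG + sQ * γm⁻¹) + κm⁻¹ * sK * κm⁻¹ * (M * γm⁻¹)) + sQ * (κm⁻¹ * (M * γm⁻¹))) +
        sG * (M * (κm⁻¹ * (M * γm⁻¹)))) * α * ‖f‖ := by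
  have hα00 : 0 ≤ α₀ := hα.trans hα0
  have hd0 : (0 : ℝ) ≤ Real.sqrt d := Real.sqrt_nonneg _
  -- the letters at `α` (opaque names with their defining equations, in the diagonal corollary's spelling)
  obtain ⟨MQ, hMQ⟩ : ∃ MQ : ℝ, MQ = Real.exp (d * K * α) := ⟨_, rfl⟩
  obtain ⟨θQ, hθQ⟩ : ∃ θQ : ℝ, θQ = Real.exp (d * K * α) - 1 := ⟨_, rfl⟩
  obtain ⟨γ, hγ⟩ : ∃ γ : ℝ, γ = 1 / (2 + 2 / a') - (Real.sqrt d * (K * α) + (Real.sqrt d * (K * α)) ^ 2 +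
      a' * (Real.exp (d * K * α) - 1) * (2 + (Real.exp (d * K * α) - 1))) := ⟨_, rfl⟩
  obtain ⟨θG, hθG⟩ : ∃ θG : ℝ, θG = 2 * (Real.sqrt d * (K * α)) * (γ⁻¹ * (Real.sqrt γ)⁻¹) + (|a'| * θQ * (MQ + MQ)) * γ⁻¹ ^ 2 := ⟨_, rfl⟩
  obtain ⟨δK, hδK⟩ : ∃ δK : ℝ, δK = MQ * (γ⁻¹ * (γ⁻¹ * θQ + θG * MQ) + θG * (γ⁻¹ * MQ)) + θQ * (γ⁻¹ * (γ⁻¹ * MQ)) := ⟨_, rfl⟩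
  obtain ⟨κ, hκ⟩ : ∃ κ : ℝ, κ = κ₀ - δK := ⟨_, rfl⟩
  -- monotonicity in `α ≤ α₀`
  have hx0 : 0 ≤ d * K * α := by positivity
  have hxle : d * K * α ≤ d * K * α₀ := by gcongr
  have hMQM : MQ ≤ M := by rw [hMQ, hMdef]; exact Real.exp_le_exp.2 hxle
  have hMQ1 : 1 ≤ MQ := by rw [hMQ]; exact Real.one_le_exp hx0
  have hM1 : 1 ≤ M := hMQ1.trans hMQM
  have hMQ0 : 0 ≤ MQ := zero_le_one.trans hMQ1
  have hθQ0 : 0 ≤ θQ := by rw [hθQ]; linarith only [Real.one_le_exp hx0]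
  -- slope of `θ_Q`: `e^x − 1 ≤ x e^x ≤ (dK·M)·α`
  have hθQs : θQ ≤ sQ * α := by
    -- `e^x − 1 ≤ x·e^x` (from `1 − x ≤ e^{−x}` times `e^x > 0`; the tree's `AreaLaw.exp_sub_one_le_mul_exp` sits behind `import Mathlib`, not imported)
    have h1 : Real.exp (d * K * α) - 1 ≤ d * K * α * Real.exp (d * K * α) := by
      have h1' : (1 - d * K * α) * Real.exp (d * K * α) ≤ 1 :=
        calc (1 - d * K * α) * Real.exp (d * K * α) ≤ Real.exp (-(d * K * α)) * Real.exp (d * K * α) :=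
              mul_le_mul_of_nonneg_right (by linarith only [Real.add_one_le_exp (-(d * K * α))]) (Real.exp_pos _).le
          _ = 1 := by rw [← Real.exp_add, neg_add_cancel, Real.exp_zero]
      have e : Real.exp (d * K * α) - 1 - d * K * α * Real.exp (d * K * α) = (1 - d * K * α) * Real.exp (d * K * α) - 1 := by ring
      linarith only [h1', e]
    have hexpM : Real.exp (d * K * α) ≤ M := by rw [← hMQ]; exact hMQM
    have h2 : d * K * α * Real.exp (d * K * α) ≤ d * K * α * M := mul_le_mul_of_nonneg_left hexpM hx0
    rw [hsQdef, hθQ]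
    calc Real.exp (d * K * α) - 1 ≤ d * K * α * M := h1.trans h2
      _ = d * K * M * α := by ring
  -- `γ ≥ γ_m` (each subtracted term is monotone in `α`)
  have hγge : γm ≤ γ := by
    rw [hγmdef, hγ]
    have hθQ0' : 0 ≤ Real.exp (d * K * α₀) - 1 := by linarith only [Real.one_le_exp (hx0.trans hxle)]
    have hθle : Real.exp (d * K * α) - 1 ≤ M - 1 := by rw [hMdef]; linarith only [Real.exp_le_exp.2 hxle]
    have h1 : Real.sqrt d * (K * α) ≤ Real.sqrt d * (K * α₀) := by gcongr
    have h2 : (Real.sqrt d * (K * α)) ^ 2 ≤ (Real.sqrt d * (K * α₀)) ^ 2 := pow_le_pow_left₀ (by positivity) h1 2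
    have h3 : a' * (Real.exp (d * K * α) - 1) * (2 + (Real.exp (d * K * α) - 1)) ≤ a' * (M - 1) * (2 + (M - 1)) := by
      have hM1' : 0 ≤ M - 1 := by linarith only [hM1]
      exact mul_le_mul (mul_le_mul_of_nonneg_left hθle ha'.le) (by linarith only [hθle]) (by linarith only [Real.one_le_exp hx0]) (by positivity)
    linarith only [h1, h2, h3]
  have hγ0 : 0 < γ := lt_of_lt_of_le hγm hγge
  have hgi : γ⁻¹ ≤ γm⁻¹ := by rw [inv_le_inv₀ hγ0 hγm]; exact hγge
  have hsgi : (Real.sqrt γ)⁻¹ ≤ (Real.sqrt γm)⁻¹ := by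
    rw [inv_le_inv₀ (Real.sqrt_pos.2 hγ0) (Real.sqrt_pos.2 hγm)]; exact Real.sqrt_le_sqrt hγge
  have hgi0 : 0 ≤ γ⁻¹ := by positivity
  have hsQ0 : 0 ≤ sQ := by rw [hsQdef]; positivity
  -- slope of `θ_G`
  have hθG0 : 0 ≤ θG := by rw [hθG]; positivity
  have hθGs : θG ≤ sG * α := by
    rw [hθG, hsGdef]
    have t1 : 2 * (Real.sqrt d * (K * α)) * (γ⁻¹ * (Real.sqrt γ)⁻¹) ≤ 2 * (Real.sqrt d * K) * (γm⁻¹ * (Real.sqrt γm)⁻¹) * α := by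
      have : γ⁻¹ * (Real.sqrt γ)⁻¹ ≤ γm⁻¹ * (Real.sqrt γm)⁻¹ := mul_le_mul hgi hsgi (by positivity) (by positivity)
      calc 2 * (Real.sqrt d * (K * α)) * (γ⁻¹ * (Real.sqrt γ)⁻¹) = (2 * (Real.sqrt d * K) * α) * (γ⁻¹ * (Real.sqrt γ)⁻¹) := by ring
        _ ≤ (2 * (Real.sqrt d * K) * α) * (γm⁻¹ * (Real.sqrt γm)⁻¹) := mul_le_mul_of_nonneg_left this (by positivity)
        _ = 2 * (Real.sqrt d * K) * (γm⁻¹ * (Real.sqrt γm)⁻¹) * α := by ring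
    have t2 : |a'| * θQ * (MQ + MQ) * γ⁻¹ ^ 2 ≤ |a'| * sQ * (M + M) * γm⁻¹ ^ 2 * α := by
      have e1 : |a'| * sQ * (M + M) * γm⁻¹ ^ 2 * α = |a'| * (sQ * α) * (M + M) * γm⁻¹ ^ 2 := by ring
      rw [e1]
      gcongr
    linarith only [t1, t2]
  -- slope of `δ_K`
  have hδK0 : 0 ≤ δK := by rw [hδK]; positivity
  have hδKs : δK ≤ sK * α := by
    rw [hδK, hsKdef]
    have hsG0 : 0 ≤ sG * α := hθG0.trans hθGs
    have e1 : (M * (γm⁻¹ * (γm⁻¹ * sQ + sG * M) + sG * (γm⁻¹ * M)) + sQ * (γm⁻¹ * (γm⁻¹ * M))) * α =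
        M * (γm⁻¹ * (γm⁻¹ * (sQ * α) + (sG * α) * M) + (sG * α) * (γm⁻¹ * M)) + (sQ * α) * (γm⁻¹ * (γm⁻¹ * M)) := by ring
    rw [e1]
    gcongr
  -- `κ ≥ κ_m`
  have hsG0 : 0 ≤ sG := by rw [hsGdef]; positivity
  have hsK0 : 0 ≤ sK := by rw [hsKdef]; positivity
  have hδKs0 : δK ≤ sK * α₀ := hδKs.trans (mul_le_mul_of_nonneg_left hα0 hsK0)
  have hκge : κm ≤ κ := by
    rw [hκmdef, hκ]
    linarith only [hδKs0]
  have hκ0 : 0 < κ := lt_of_lt_of_le hκm hκge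
  -- the closure (§2 of `B9Eq325RLipschitzClosed`) at `α` on the diagonal — `t = Kα`, `ρ = e^{dKα} − 1`, `s = 1` — then §1
  have hLr : (0 : ℝ) < L := by exact_mod_cast Nat.pos_of_ne_zero (NeZero.ne L)
  have hηL0 : 0 < η * L := by rw [hηL]; exact one_pos
  have hη0 : 0 < η := pos_of_mul_pos_left hηL0 hLr.le
  have hs : c₁ * (η * L) ^ 2 = c₀ * (L : ℝ) ^ d := by rw [hηL, one_pow, mul_one, hw]
  have hone : (η * L)⁻¹ = 1 := by rw [hηL, inv_one]
  have ht : ‖((η : ℂ))⁻¹‖ * (K * α * η) ≤ K * α := by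
    rw [norm_inv, Complex.norm_real, Real.norm_eq_abs, abs_of_pos hη0]
    rw [show η⁻¹ * (K * α * η) = K * α * (η⁻¹ * η) by ring, inv_mul_cancel₀ hη0.ne', mul_one]
  have hρ := rho_le_exp_sub_one (d := d) hK hα hηL
  have hmain := norm_RofU_sub_RofU_one_le_of_letters L m φ c₀ η c₁ ha' U hRS (by positivity : 0 ≤ K * α * η) hRε hη hηL0 (le_of_eq hηL) hs
    (γ := γ) (MQ := MQ) (θQ := θQ) (θG := θG) (δK := δK) (κ := κ) ht hρ hκ1
    (by rw [hγ, hone]; ring) (by rw [hMQ, hone]; ring) (by rw [hθQ, hone, mul_one]) hθG hδK hκ hγ0 hκ0 f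
  refine hmain.trans (mul_le_mul_of_nonneg_right ?_ (norm_nonneg _))
  exact CR_le_linear hγm hγge hκm hκge hMQ0 hMQM hθG0 hθGs hθQ0 hθQs hδK0 hδKs

end Diagonal

end Literature.MathematicalPhysics.QuantumFieldTheory.Balaban1983to89.B9Eq325RLipschitzClosedLinear

end
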